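import Mathlib
import HarnessLib
import Literature.RingTheory.CohomologyAnnihilator.Basic

/-!
# Crux `NoZenoR` / `NoZeno` (stmt-ResolutionOfSingularities-19943 / -16483), line `sandwich-cluster`,
# stub `stub_skyPrincipal` — THE BRIDGE between the scheme-side G-layer and the registered
# `Subalgebra k K`-world (lead res-L0-w44-lead-1, KERNEL-L0 §16 R2)

Route `ResolutionOfSingularities/HomologicalConductor`.  OURS (cell res-hironaka, crux chain W4.4);
nothing here is a statement of the manuscript under review (Hironaka 2017); AI-written, weaker than
expert review.  ROUTE-INDEPENDENT: this module imports no `Theses` file (theses-cone lint); the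
one-line conversion to the route's `let ca` (`Ideal.span {s : S | (s : K) ∈ ca T}` is the extension of
`cohomologyAnnihilator ↥T` along `T ↪ S`, by `Subalgebra.image_coe_cohomologyAnnihilator`) is done in
the skeleton.

The G-layer of the Lean road to `stub_skyPrincipal` (CRUX-PLAN W4.4 v6 §B) lives on the scheme side:
a `T`-scheme `π : X ⟶ Spec T` (`T = T_m` a stage of the tower, `X` its minimal resolution) and the
statement **(G4′)** «the ideal sheaf `ca(T)·𝒪_X` is invertible at the points of the closed fibre»,
rendered stalk-wise as principality of the extension of `cohomologyAnnihilator ↥T` along the structure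
map `T ≅ Γ(Spec T) → Γ(X, 𝒪_X) → 𝒪_{X,x}`, i.e. along
`(X.presheaf.germ ⊤ x trivial).hom.comp (π.appTop.hom.comp (Scheme.ΓSpecIso (.of T)).inv.hom)`
(spelled out, no new definition).  The registered stub speaks about the extension of
`cohomologyAnnihilator ↥T` to a local `k`-subalgebra `S ⊇ T` of `K` (a sky point).  This file proves
the transfer between the two worlds once and for all, so that no G-layer seat touches the route's
`let`-tower and no sky-point seat touches sheaves:

* `isPrincipal_map_inclusion_of_ringHom` — PURE ALGEBRA: if the inclusion `T ↪ S` factors as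
  `T → B → S` and `ca(T)·B` is principal, then `ca(T)·S` is principal (`B = 𝒪_{X,x}` for us);
* `stalkClosedPointTo_germ_appTop` — for a lift `l : Spec S ⟶ X` of `Spec f : Spec S ⟶ Spec T`
  through `π`, Mathlib's local homomorphism `Scheme.stalkClosedPointTo l : 𝒪_{X, l(𝔪_S)} → S`
  restricts to `f` on `T` (`germ_stalkMap`, `germ_stalkClosedPointIso_hom`, `ΓSpecIso_naturality`);
* `base_closedPoint_eq_of_isLocalHom` — the lifted closed point lies in the closed fibre when `f` is
  local; `isLocalHom_inclusion_of_dominates` — the route's `hdom` binder makes `T ↪ S` local;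
* `isPrincipal_map_inclusion_of_lift`, **`caPrincipal_of_invertible_of_lift`** — the assembly shape
  consumed by the skeleton: (G4′ on the closed fibre) ∧ (P1.3′: a lift `Spec S ⟶ X` over `Spec T`
  exists) ⇒ `ca(T)·S` principal.

References: O. Zariski, P. Samuel, *Commutative Algebra* II (1960), Ch. VI §17 (local rings of the
points of a model inside the function field; domination) [`ZariskiSamuel1960`]; S. Iyengar,
R. Takahashi, IMRN 2016 (arXiv:1404.1476), Def. 2.1 [`IyengarTakahashi2014`].
-/

noncomputable section

-- single-problem summit: the doubled namespace component `ResolutionOfSingularities` is forced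
set_option linter.dupNamespace false

namespace Summit.ResolutionOfSingularities.ResolutionOfSingularities.Theorems.NoZeno.SandwichCluster

open CategoryTheory AlgebraicGeometry TopologicalSpace IsLocalRing
open Literature.RingTheory.CohomologyAnnihilator (cohomologyAnnihilator)

/-! ## Pure algebra: principality passes along any factorisation `T → B → S` of the inclusion -/

section Algebra

variable {k K : Type*} [Field k] [Field K] [Algebra k K]

/-- **Principality transfer (ring form).**  If the inclusion of `k`-subalgebras `T ↪ S` of `K`
factors as `T →ι B →φ S` through a commutative ring `B` and the extension `ca(T)·B` of the
cohomology annihilator is principal, then so is `ca(T)·S` (the image of a principal ideal is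
principal).  For us `B = 𝒪_{X,x}`. [folklore] -/
theorem isPrincipal_map_inclusion_of_ringHom (T S : Subalgebra k K) (hTS : T ≤ S) {B : Type*}
    [CommRing B] (ι : ↥T →+* B) (φ : B →+* ↥S)
    (hφ : ∀ t : ↥T, φ (ι t) = Subalgebra.inclusion hTS t)
    (h : (Ideal.map ι (cohomologyAnnihilator ↥T)).IsPrincipal) :
    (Ideal.map (Subalgebra.inclusion hTS).toRingHom (cohomologyAnnihilator ↥T)).IsPrincipal := by
  have hcomp : φ.comp ι = (Subalgebra.inclusion hTS).toRingHom := RingHom.ext hφ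
  rw [← hcomp, ← Ideal.map_map]
  obtain ⟨g, hg⟩ := h
  refine ⟨⟨φ g, ?_⟩⟩
  rw [hg, Ideal.submodule_span_eq, Ideal.map_span, Set.image_singleton, Ideal.submodule_span_eq]

/-- The inclusion of a DOMINATED subalgebra is a local homomorphism («every element of `T`
invertible in `S` is invertible in `T`» — the route's `hdom` binder, in the `t⁻¹ ∈ S → t⁻¹ ∈ T`
form). [folklore] -/
theorem isLocalHom_inclusion_of_dominates {T S : Subalgebra k K} (hTS : T ≤ S)
    (hdom : ∀ t : K, t ∈ T → t⁻¹ ∈ S → t⁻¹ ∈ T) :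
    IsLocalHom (Subalgebra.inclusion hTS).toRingHom := by
  refine ⟨fun t ht => ?_⟩
  rw [AlgHom.toRingHom_eq_coe, RingHom.coe_coe] at ht
  by_cases h0 : (t : K) = 0
  · exfalso
    have hz : Subalgebra.inclusion hTS t = 0 := Subtype.ext (by simpa using h0)
    rw [hz] at ht
    exact not_isUnit_zero ht
  -- a unit of `S`: its inverse in `K` lies in `S`
  have hinvS : (t : K)⁻¹ ∈ S := by
    obtain ⟨u, hu⟩ := ht.exists_left_inv
    have huK : (u : K) * (t : K) = 1 := by
      have := congrArg Subtype.val hu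
      simpa using this
    rw [inv_eq_of_mul_eq_one_left huK]
    exact u.2
  -- hence in `T`, so `t` is a unit of `T`
  have hinvT : (t : K)⁻¹ ∈ T := hdom t t.2 hinvS
  exact IsUnit.of_mul_eq_one ⟨(t : K)⁻¹, hinvT⟩ (Subtype.ext (by simp [mul_inv_cancel₀ h0]))

end Algebra

/-! ## Scheme form: the lift `Spec S ⟶ X` of the lifting lemma transports principality -/

section Scheme

universe u

/-- **Compatibility of the lift with the structure maps.**  For `l : Spec S ⟶ X` with
`l ≫ π = Spec f` (`f : T → S`), the local homomorphism `Scheme.stalkClosedPointTo l : 𝒪_{X, l(𝔪_S)} → S`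
composed with the structure map `T → Γ(X, 𝒪_X) → 𝒪_{X, l(𝔪_S)}` is `f`. [folklore] -/
theorem stalkClosedPointTo_germ_appTop {T S : Type u} [CommRing T] [CommRing S] [IsLocalRing S]
    {X : Scheme.{u}} (π : X ⟶ Spec (.of T)) (f : T →+* S) (l : Spec (.of S) ⟶ X)
    (hl : l ≫ π = Spec.map (CommRingCat.ofHom f)) (t : T) :
    (Scheme.stalkClosedPointTo l).hom ((X.presheaf.germ ⊤ (l (closedPoint S)) trivial).hom
      (π.appTop.hom ((Scheme.ΓSpecIso (.of T)).inv.hom t))) = f t := by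
  -- `germ ≫ stalkMap = app ≫ germ` and `germ_𝔪 ≫ stalkClosedPointIso = ΓSpecIso`
  have h1 : X.presheaf.germ ⊤ (l (closedPoint S)) trivial ≫ Scheme.stalkClosedPointTo l =
      l.appTop ≫ (Scheme.ΓSpecIso (.of S)).hom := by
    rw [Scheme.stalkClosedPointTo, Scheme.Hom.germ_stalkMap_assoc]
    change l.appTop ≫ (Spec (.of S)).presheaf.germ ⊤ (closedPoint S) trivial ≫
      (stalkClosedPointIso (.of S)).hom = _
    rw [germ_stalkClosedPointIso_hom]
  have h2 : π.appTop ≫ l.appTop = (Spec.map (CommRingCat.ofHom f)).appTop := by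
    rw [← Scheme.Hom.comp_appTop, hl]
  have h3 : (Scheme.ΓSpecIso (.of T)).inv ≫ π.appTop ≫ l.appTop ≫ (Scheme.ΓSpecIso (.of S)).hom =
      CommRingCat.ofHom f := by
    rw [← Category.assoc π.appTop, h2, Scheme.ΓSpecIso_naturality, Iso.inv_hom_id_assoc]
  have h4 := congrArg (fun g : CommRingCat.of T ⟶ CommRingCat.of S => g.hom t) h3
  simp only [CommRingCat.hom_comp, RingHom.coe_comp, Function.comp_apply, CommRingCat.hom_ofHom] at h4
  rw [← h4]
  change (X.presheaf.germ ⊤ (l (closedPoint S)) trivial ≫ Scheme.stalkClosedPointTo l).hom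
      (π.appTop.hom ((Scheme.ΓSpecIso (.of T)).inv.hom t)) = _
  rw [h1]
  rfl

/-- If `f : T → S` is a local homomorphism of local rings and `l : Spec S ⟶ X` lifts `Spec f`
through `π : X ⟶ Spec T`, the lifted closed point lies in the closed fibre of `π`. [folklore] -/
theorem base_closedPoint_eq_of_isLocalHom {T S : Type u} [CommRing T] [CommRing S] [IsLocalRing T]
    [IsLocalRing S] {X : Scheme.{u}} (π : X ⟶ Spec (.of T)) (f : T →+* S) [IsLocalHom f]
    (l : Spec (.of S) ⟶ X) (hl : l ≫ π = Spec.map (CommRingCat.ofHom f)) :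
    π (l (closedPoint S)) = closedPoint T := by
  rw [← Scheme.Hom.comp_apply, hl]
  haveI : IsLocalHom (CommRingCat.ofHom f).hom := ‹IsLocalHom f›
  exact Spec_closedPoint

end Scheme

/-! ## The assembly shapes consumed by the skeleton -/

section Assembly

variable {k K : Type} [Field k] [Field K] [Algebra k K]

/-- **Principality transfer (scheme form).**  Let `π : X ⟶ Spec T` (`T ≤ S` `k`-subalgebras of
`K`, `S` local), `l : Spec S ⟶ X` a lift of `Spec S ⟶ Spec T` through `π` (the lifting lemma P1.3
for a sky point `S`), and suppose `ca(T)·𝒪_{X,x}` is principal at `x = l(𝔪_S)` (G4′ at that point).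
Then `ca(T)·S` is principal. [folklore] -/
theorem isPrincipal_map_inclusion_of_lift (T S : Subalgebra k K) (hTS : T ≤ S) [IsLocalRing ↥S]
    {X : Scheme.{0}} (π : X ⟶ Spec (.of ↥T)) (l : Spec (.of ↥S) ⟶ X)
    (hl : l ≫ π = Spec.map (CommRingCat.ofHom (Subalgebra.inclusion hTS).toRingHom))
    (hx : (Ideal.map (((X.presheaf.germ ⊤ (l (closedPoint ↥S)) trivial).hom.comp
      (π.appTop.hom.comp (Scheme.ΓSpecIso (.of ↥T)).inv.hom) : ↥T →+* X.presheaf.stalk _))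
        (cohomologyAnnihilator ↥T)).IsPrincipal) :
    (Ideal.map (Subalgebra.inclusion hTS).toRingHom (cohomologyAnnihilator ↥T)).IsPrincipal :=
  isPrincipal_map_inclusion_of_ringHom T S hTS
    (((X.presheaf.germ ⊤ (l (closedPoint ↥S)) trivial).hom.comp
      (π.appTop.hom.comp (Scheme.ΓSpecIso (.of ↥T)).inv.hom) : ↥T →+* X.presheaf.stalk _))
    (Scheme.stalkClosedPointTo l).hom
    (fun t => stalkClosedPointTo_germ_appTop π (Subalgebra.inclusion hTS).toRingHom l hl t) hx

/-- **(G4′ on the closed fibre) ∧ (P1.3′ lift) ⇒ `ca(T)·S` principal** — the shape of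
`stub_skyPrincipal` after the bridge (KERNEL-L0 §16 R2): for a stage `T` and a local `S ⊇ T`
dominating `T`, if `ca(T)·𝒪_{X,x}` is principal at every point `x` of the closed fibre of a
`T`-scheme `π : X ⟶ Spec T` (G4′: for `X` the minimal resolution this is «`ca(T)·𝒪_X` invertible»,
THEOREM A), and `Spec S ⟶ Spec T` lifts through `π` (P1.3′: sky points dominate closed points of
the minimal resolution), then the extension of `cohomologyAnnihilator ↥T` to `S` is principal.
[this work] -/
theorem caPrincipal_of_invertible_of_lift (T S : Subalgebra k K) (hTS : T ≤ S) [IsLocalRing ↥T]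
    [IsLocalRing ↥S] (hdom : ∀ t : K, t ∈ T → t⁻¹ ∈ S → t⁻¹ ∈ T)
    {X : Scheme.{0}} (π : X ⟶ Spec (.of ↥T))
    (hG : ∀ x : X, π x = closedPoint ↥T →
      (Ideal.map (((X.presheaf.germ ⊤ x trivial).hom.comp
        (π.appTop.hom.comp (Scheme.ΓSpecIso (.of ↥T)).inv.hom) : ↥T →+* X.presheaf.stalk x))
        (cohomologyAnnihilator ↥T)).IsPrincipal)
    (hP : ∃ l : Spec (.of ↥S) ⟶ X,
      l ≫ π = Spec.map (CommRingCat.ofHom (Subalgebra.inclusion hTS).toRingHom)) :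
    (Ideal.map (Subalgebra.inclusion hTS).toRingHom (cohomologyAnnihilator ↥T)).IsPrincipal := by
  obtain ⟨l, hl⟩ := hP
  haveI := isLocalHom_inclusion_of_dominates hTS hdom
  exact isPrincipal_map_inclusion_of_lift T S hTS π l hl
    (hG _ (base_closedPoint_eq_of_isLocalHom π (Subalgebra.inclusion hTS).toRingHom l hl))

end Assembly

end Summit.ResolutionOfSingularities.ResolutionOfSingularities.Theorems.NoZeno.SandwichCluster

end
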